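import Literature.MathematicalPhysics.QuantumFieldTheory.Balaban1983to89.NodeOLettersSqrtExpDecay

/-!
# `Balaban1983to89.B13InverseDecayWeightedPairing` — T. Bałaban, *Propagators for lattice gauge theories in a background field*, Commun. Math. Phys. **99** (1985)
# 389–434 [Balaban1985BackgroundPropagators], Thm 3.2 and (3.48) p. 398 («(Q′G′²Q′*)⁻¹(U; y, y′) … ≤ … e^{−δ₀d(y,y′)}») for an operator POSITIVE IN THE BLOCK-VOLUME
# PAIRING ((3.25) p. 394, Thm 3.11 p. 416), with [4] = *Propagators … II*, Commun. Math. Phys. **96** (1984) 223–250 [Balaban1984PropagatorsII] Lemma 2.1 (2.61)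
# p. 234 ∕ Prop 2.3 p. 238; *Renormalization group approach … II*, Commun. Math. Phys. **116** (1988) 1–22 [Balaban1988RG2Cluster] (2.7) p. 13: THE COMBES–THOMAS
# INVERSE DECAY FOR AN EXPONENTIALLY LOCALISED OPERATOR COERCIVE IN A WEIGHTED PAIRING (generic finite-dimensional bookkeeping over the tree's almost-local
# engine `B13Sqrt27AccretiveAlmostLocal.almostLocal_inverse_decay` and `NodeOLettersSqrtExpDecay.weightedSums_le_half_of_expDecay`).

statement-level [folklore] matrix analysis (Combes–Thomas 1973 ∕ Aizenman–Warzel §10.3 shape) with citation tags; kernel-checked; THEOREMS ONLY (no `def`, no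
`structure`, no instance, no notation); nothing of Bałaban's operators is constructed or asserted; nothing here is a claim about the Yang–Mills mass gap; no node
is discharged; count-neutral.

WHY THIS FILE (cell `pub-ymgap`, HUMAN RULING D-0062 ∕ D-0149, Track A node N10 = [B13]; seat `pub-ymgap-dag-n10-c` g15, INTENT-5 = module 80; census
`N10-RESIDUAL-CENSUS-v17.md` item 2 and the LOCATED recipe of INBOX l.29493).  The N10 junction's road for an inverse factor (`B13InverseOperatorCoordinates`
§3–§5, `B13OpsYPencilXQuad` §4) displays TWO facts at the one real background: invertibility and a pointwise exponential kernel bound of the inverse.  For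
print's second inverse `C(U₀) = (Q′G′²Q′*)⁻¹(U₀)` on the (3.35) class the tree holds: the LOWER BOUND of `X = Q′G′²Q′*` in the BLOCK-VOLUME pairing at every
unitary background (dag-n06-w1 `B9Thm32SiteXBoundsY.trIP_XY_parSymY_ge`), the exponential kernel decay of `G′(U₀)` (`B13GreenPrimeSymLettersOfReg335` §1) and the
locality of `Q′`; what turns these into the (3.48) decay of `X⁻¹` is a Combes–Thomas argument for an operator that is (i) exponentially localised (not finite range)
and (ii) coercive in a WEIGHTED (not the flat) pairing.  The tree's engine `almostLocal_inverse_decay` handles (i) for FLAT accretivity with `(e^{κd} − 1)`-weighted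
row ∕ column sums, and `weightedSums_le_half_of_expDecay` produces those sums from exponential decay.  THIS FILE supplies the two generic corollaries the recipe
needs: §1 the plain composition (flat), §2 the diagonal conjugation `W^{1∕2} A W^{−1∕2}` that trades a `W`-weighted coercivity for a flat one at the price of the
weight-ratio numeral `Θ` (block volumes: `Θ ≤ L^{k(d+1)∕2}`), §3 the weighted statement.  Step (ii) of the recipe — the entry decay of `X(U₀)` itself — and the
assembly are NOT here.

WHAT THIS FILE PROVES (all `theorem`s; `A : Matrix n n ℂ`, `d` a real pseudo-metric with `d ≥ 0`, `d i i = 0`, symmetric, triangle inequality).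
* §1 ★ `inverse_decay_of_expDecay` — flat `m`-accretive (`m·Σ‖v_i‖² ≤ Re Σ v̄_i (Av)_i`, `m > 0`), `‖A i l‖ ≤ a·e^{−κ₀ d(i,l)}` (`a ≥ 0`, `κ₀ > 0`), half-rate volume
  sums `Σ_l e^{−(κ₀∕2)d(i,l)} ≤ c_V` (rows and columns), `0 ≤ κ ≤ κ₀∕4`, `8aκc_V ≤ mκ₀` ⇒ `IsUnit A.det ∧ ‖A⁻¹ i j‖ ≤ (4∕m)·e^{−κ d(i,j)}`;
  `inverse_decay_of_expDecay_exists` (a rate `κ > 0` depending on `(m; a, κ₀, c_V)` only).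
* §2 `conjDiag_apply` (entries of `diagonal √W · A · diagonal (√W)⁻¹`), ★ `accretive_conjDiag_of_weighted` (`W`-weighted `m`-accretive ⇒ the conjugate is flat
  `m`-accretive), `norm_conjDiag_le` (entry decay with constant `Θ·a`), `inv_eq_conjDiag_inv` (`A⁻¹ = diagonal (√W)⁻¹ · (conjugate)⁻¹ · diagonal √W` once the
  conjugate is invertible, with `IsUnit A.det`).
* §3 ★★★ `inverse_decay_of_expDecay_weighted` — `W`-weighted `m`-accretive (`0 < W i`), `‖A i l‖ ≤ a·e^{−κ₀ d(i,l)}`, weight-ratio numeral `√W_i ≤ Θ·√W_j`, volume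
  sums, `0 ≤ κ ≤ κ₀∕4`, `8(Θa)κc_V ≤ mκ₀` ⇒ `IsUnit A.det ∧ ‖A⁻¹ i j‖ ≤ Θ·(4∕m)·e^{−κ d(i,j)}`; `…_exists` (some `κ > 0`).
HONEST FRAMING: finite sums and two calls of tree theorems; nothing of Bałaban's constructed; that `X(U₀)` at a (3.35) background meets the hypotheses (positivity
in the block-volume pairing = n06-w1's theorem; entry decay = step (ii)) is NOT claimed here; N06 ∕ N10 NOT discharged; K1⁷ NOT closed; counts unmoved (typed
28∕28 · discharged 5∕27); 0 `def`, 0 `sorry`, standard axioms; one finite 𝕋⁴ programme at fixed ε — R4 closes the conditional finite-𝕋⁴ rung `BalabanLadder.UV`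
only; the YM mass gap (Clay) is NOT proved by any of this; nothing continuum ∕ ℝ⁴ ∕ OS.

References: T. Bałaban, CMP 99 (1985) 389–434 [Balaban1985BackgroundPropagators] (3.25) p.394, Thm 3.2 (3.48) p.398, Thm 3.10 (3.107)–(3.108) pp.415–416, Thm 3.11
p.416; CMP 96 (1984) 223–250 [Balaban1984PropagatorsII] Lemma 2.1 (2.61) p.234, Prop 2.3 p.238; CMP 116 (1988) 1–22 [Balaban1988RG2Cluster] (2.7) p.13, (2.16) p.16;
J.-M. Combes, L. Thomas, CMP 34 (1973) 251–270 [CombesThomas1973]; M. Aizenman, S. Warzel, *Random Operators* (AMS 2015) §10.3 [AizenmanWarzel2015].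
-/

noncomputable section

namespace Literature.MathematicalPhysics.QuantumFieldTheory.Balaban1983to89.B13InverseDecayWeightedPairing

open Finset
open scoped Matrix ComplexConjugate
open Literature.MathematicalPhysics.QuantumFieldTheory.Balaban1983to89.B13Sqrt27AccretiveAlmostLocal (almostLocal_inverse_decay)
open Literature.MathematicalPhysics.QuantumFieldTheory.Balaban1983to89.NodeOLettersSqrtExpDecay (weightedSums_le_half_of_expDecay exists_uniform_rate)

variable {n : Type*} [Fintype n] [DecidableEq n]

/-! ## §1. Exponential localisation + flat accretivity ⟹ exponential decay of the inverse -/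

section Flat

/-- ★ **COMBES–THOMAS FOR AN EXPONENTIALLY LOCALISED ACCRETIVE MATRIX**: `m`-accretive in the flat pairing, `‖A i l‖ ≤ a·e^{−κ₀ d(i,l)}`, half-rate volume sums
`≤ c_V` ⟹ for every rate `0 ≤ κ ≤ κ₀∕4` with `8aκc_V ≤ mκ₀`: `A` is invertible and `‖A⁻¹ i j‖ ≤ (4∕m)·e^{−κ d(i,j)}` (the tree's `almostLocal_inverse_decay` fed by
`weightedSums_le_half_of_expDecay`). [cite: Balaban1985BackgroundPropagators, Thm 3.2 (3.48) p.398, Thm 3.10 (3.108) p.416; Balaban1984PropagatorsII, Lemma 2.1 (2.61) p.234;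
Balaban1988RG2Cluster, (2.7) p.13; AizenmanWarzel2015, §10.3 (Combes–Thomas estimate)] -/
theorem inverse_decay_of_expDecay (d : n → n → ℝ) (hd0 : ∀ i, d i i = 0) (hds : ∀ i j, d i j = d j i)
    (hdt : ∀ i j k, d i k ≤ d i j + d j k) (hdnn : ∀ i j, 0 ≤ d i j) (A : Matrix n n ℂ)
    {m a κ₀ κ cV : ℝ} (hm : 0 < m) (ha : 0 ≤ a) (hκ₀ : 0 < κ₀) (hκ : 0 ≤ κ) (hκ4 : κ ≤ κ₀ / 4) (hκm : 8 * a * κ * cV ≤ m * κ₀)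
    (hacc : ∀ v : n → ℂ, m * ∑ i, ‖v i‖ ^ 2 ≤ (∑ i, star (v i) * (A *ᵥ v) i).re)
    (hA : ∀ i l, ‖A i l‖ ≤ a * Real.exp (-(κ₀ * d i l)))
    (hvol : ∀ i, ∑ l, Real.exp (-(κ₀ / 2 * d i l)) ≤ cV) (hvol' : ∀ l, ∑ i, Real.exp (-(κ₀ / 2 * d i l)) ≤ cV) :
    IsUnit A.det ∧ ∀ i j, ‖A⁻¹ i j‖ ≤ 4 / m * Real.exp (-(κ * d i j)) := by
  obtain ⟨hrow, hcol⟩ := weightedSums_le_half_of_expDecay d hdnn A ha hκ₀ hκ hκ4 hκm hA hvol hvol'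
  exact almostLocal_inverse_decay d hd0 hds hdt A hm hκ (by linarith) le_rfl hacc hrow hcol

/-- **… at SOME strictly positive rate** depending on the letters `(m; a, κ₀, c_V)` only (`exists_uniform_rate`).
[cite: Balaban1985BackgroundPropagators, Thm 3.2 (3.48) p.398; Balaban1988RG2Cluster, (2.7) p.13; AizenmanWarzel2015, §10.3] -/
theorem inverse_decay_of_expDecay_exists (d : n → n → ℝ) (hd0 : ∀ i, d i i = 0) (hds : ∀ i j, d i j = d j i)
    (hdt : ∀ i j k, d i k ≤ d i j + d j k) (hdnn : ∀ i j, 0 ≤ d i j) (A : Matrix n n ℂ)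
    {m a κ₀ cV : ℝ} (hm : 0 < m) (ha : 0 ≤ a) (hκ₀ : 0 < κ₀) (hcV : 0 ≤ cV)
    (hacc : ∀ v : n → ℂ, m * ∑ i, ‖v i‖ ^ 2 ≤ (∑ i, star (v i) * (A *ᵥ v) i).re)
    (hA : ∀ i l, ‖A i l‖ ≤ a * Real.exp (-(κ₀ * d i l)))
    (hvol : ∀ i, ∑ l, Real.exp (-(κ₀ / 2 * d i l)) ≤ cV) (hvol' : ∀ l, ∑ i, Real.exp (-(κ₀ / 2 * d i l)) ≤ cV) :
    ∃ κ : ℝ, 0 < κ ∧ IsUnit A.det ∧ ∀ i j, ‖A⁻¹ i j‖ ≤ 4 / m * Real.exp (-(κ * d i j)) := by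
  obtain ⟨κ, hκ0, hκ4, hκm⟩ := exists_uniform_rate (m := m) (a := a) (κ₀ := κ₀) (cV := cV) hm hκ₀ ha hcV
  exact ⟨κ, hκ0, inverse_decay_of_expDecay d hd0 hds hdt hdnn A hm ha hκ₀ hκ0.le hκ4 hκm hacc hA hvol hvol'⟩

end Flat

/-! ## §2. Diagonal conjugation: a weighted coercivity becomes a flat one -/

section Conjugation

variable (W : n → ℝ) (A : Matrix n n ℂ)

/-- the entries of the conjugate `diagonal √W · A · diagonal (√W)⁻¹`: `√W_i · A i j · (√W_j)⁻¹`. [folklore]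
[cite: Balaban1985BackgroundPropagators, (3.25) p.394 (the block-volume pairing), dictionary] -/
theorem conjDiag_apply (i j : n) :
    (Matrix.diagonal (fun k => ((Real.sqrt (W k) : ℝ) : ℂ)) * A * Matrix.diagonal (fun k => (((Real.sqrt (W k))⁻¹ : ℝ) : ℂ))) i j =
      ((Real.sqrt (W i) : ℝ) : ℂ) * A i j * (((Real.sqrt (W j))⁻¹ : ℝ) : ℂ) := by
  rw [Matrix.mul_diagonal, Matrix.diagonal_mul]

/-- ★ **WEIGHTED COERCIVITY ⟹ FLAT COERCIVITY OF THE CONJUGATE**: if `m·Σ_i W_i‖v_i‖² ≤ Re Σ_i W_i v̄_i (Av)_i` for all `v` (`A` is `m`-accretive in the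
`W`-weighted pairing, `W_i > 0` — print's block-volume pairing), then `diagonal √W · A · diagonal (√W)⁻¹` is `m`-accretive in the FLAT pairing.
[cite: Balaban1985BackgroundPropagators, (3.25) p.394, Thm 3.11 p.416; Balaban1984PropagatorsII, Prop 2.3 p.238] -/
theorem accretive_conjDiag_of_weighted (hW : ∀ i, 0 < W i) {m : ℝ}
    (hacc : ∀ v : n → ℂ, m * ∑ i, W i * ‖v i‖ ^ 2 ≤ (∑ i, (W i : ℂ) * (star (v i) * (A *ᵥ v) i)).re) (g : n → ℂ) :
    m * ∑ i, ‖g i‖ ^ 2 ≤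
      (∑ i, star (g i) * ((Matrix.diagonal (fun k => ((Real.sqrt (W k) : ℝ) : ℂ)) * A *
        Matrix.diagonal (fun k => (((Real.sqrt (W k))⁻¹ : ℝ) : ℂ))) *ᵥ g) i).re := by
  -- `v := (√W)⁻¹ g`
  set v : n → ℂ := fun k => (((Real.sqrt (W k))⁻¹ : ℝ) : ℂ) * g k with hv
  have hsq : ∀ i, Real.sqrt (W i) * Real.sqrt (W i) = W i := fun i => Real.mul_self_sqrt (hW i).le
  have hs0 : ∀ i, Real.sqrt (W i) ≠ 0 := fun i => (Real.sqrt_pos.2 (hW i)).ne'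
  -- the flat quadratic form of the conjugate at `g` IS the weighted form of `A` at `v`
  have hDg : Matrix.diagonal (fun k => (((Real.sqrt (W k))⁻¹ : ℝ) : ℂ)) *ᵥ g = v := by
    funext k; rw [Matrix.mulVec_diagonal]
  have hmv : ∀ i, ((Matrix.diagonal (fun k => ((Real.sqrt (W k) : ℝ) : ℂ)) * A *
        Matrix.diagonal (fun k => (((Real.sqrt (W k))⁻¹ : ℝ) : ℂ))) *ᵥ g) i = ((Real.sqrt (W i) : ℝ) : ℂ) * (A *ᵥ v) i := by
    intro i
    rw [← Matrix.mulVec_mulVec, ← Matrix.mulVec_mulVec, hDg, Matrix.mulVec_diagonal]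
  have hform : ∀ i, star (g i) * ((Matrix.diagonal (fun k => ((Real.sqrt (W k) : ℝ) : ℂ)) * A *
        Matrix.diagonal (fun k => (((Real.sqrt (W k))⁻¹ : ℝ) : ℂ))) *ᵥ g) i = (W i : ℂ) * (star (v i) * (A *ᵥ v) i) := by
    intro i
    have hstar : star (v i) = (((Real.sqrt (W i))⁻¹ : ℝ) : ℂ) * star (g i) := by
      simp only [hv, star_mul', Complex.star_def, Complex.conj_ofReal]
    have e : (W i : ℂ) = ((Real.sqrt (W i) : ℝ) : ℂ) * ((Real.sqrt (W i) : ℝ) : ℂ) := by rw [← Complex.ofReal_mul, hsq]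
    have hinv : (((Real.sqrt (W i))⁻¹ : ℝ) : ℂ) * ((Real.sqrt (W i) : ℝ) : ℂ) = 1 := by
      rw [← Complex.ofReal_mul, inv_mul_cancel₀ (hs0 i), Complex.ofReal_one]
    rw [hmv i, hstar, e]
    linear_combination (-(star (g i) * (A *ᵥ v) i * ((Real.sqrt (W i) : ℝ) : ℂ))) * hinv
  have hnorm : ∀ i, W i * ‖v i‖ ^ 2 = ‖g i‖ ^ 2 := by
    intro i
    rw [hv]
    simp only [norm_mul, Complex.norm_real, Real.norm_eq_abs, abs_inv, abs_of_pos (Real.sqrt_pos.2 (hW i))]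
    rw [mul_pow, inv_pow, Real.sq_sqrt (hW i).le, ← mul_assoc, mul_inv_cancel₀ (hW i).ne', one_mul]
  calc m * ∑ i, ‖g i‖ ^ 2 = m * ∑ i, W i * ‖v i‖ ^ 2 := by simp_rw [hnorm]
    _ ≤ (∑ i, (W i : ℂ) * (star (v i) * (A *ᵥ v) i)).re := hacc v
    _ = _ := by simp_rw [hform]

/-- the conjugate's entries decay with the constant multiplied by the weight-ratio numeral `Θ` (`√W_i ≤ Θ·√W_j` for all `i, j`).
[cite: Balaban1985BackgroundPropagators, Thm 3.2 (3.48) p.398, dictionary] -/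
theorem norm_conjDiag_le (hW : ∀ i, 0 < W i) {Θ : ℝ} (hΘ : ∀ i j, Real.sqrt (W i) ≤ Θ * Real.sqrt (W j))
    (d : n → n → ℝ) {a κ₀ : ℝ} (hA : ∀ i l, ‖A i l‖ ≤ a * Real.exp (-(κ₀ * d i l))) (i j : n) :
    ‖(Matrix.diagonal (fun k => ((Real.sqrt (W k) : ℝ) : ℂ)) * A * Matrix.diagonal (fun k => (((Real.sqrt (W k))⁻¹ : ℝ) : ℂ))) i j‖ ≤
      Θ * a * Real.exp (-(κ₀ * d i j)) := by
  rw [conjDiag_apply, norm_mul, norm_mul, Complex.norm_real, Complex.norm_real, Real.norm_eq_abs, Real.norm_eq_abs,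
    abs_of_pos (Real.sqrt_pos.2 (hW i)), abs_of_pos (inv_pos.2 (Real.sqrt_pos.2 (hW j)))]
  have hr : Real.sqrt (W i) * (Real.sqrt (W j))⁻¹ ≤ Θ := by
    rw [← div_eq_mul_inv, div_le_iff₀ (Real.sqrt_pos.2 (hW j))]; exact hΘ i j
  have hΘ0 : 0 ≤ Θ := by
    have h := hΘ i i
    have hp := Real.sqrt_pos.2 (hW i)
    nlinarith
  calc Real.sqrt (W i) * ‖A i j‖ * (Real.sqrt (W j))⁻¹ = (Real.sqrt (W i) * (Real.sqrt (W j))⁻¹) * ‖A i j‖ := by ring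
    _ ≤ Θ * (a * Real.exp (-(κ₀ * d i j))) := mul_le_mul hr (hA i j) (norm_nonneg _) hΘ0
    _ = Θ * a * Real.exp (-(κ₀ * d i j)) := by ring

/-- un-conjugating the inverse: if the conjugate `B = diagonal √W · A · diagonal (√W)⁻¹` is invertible then
`A⁻¹ = diagonal (√W)⁻¹ · B⁻¹ · diagonal √W` and `A` is invertible. [folklore] [cite: Balaban1985BackgroundPropagators, Thm 3.2 p.398, dictionary] -/
theorem inv_eq_conjDiag_inv (hW : ∀ i, 0 < W i)
    (hB : IsUnit (Matrix.diagonal (fun k => ((Real.sqrt (W k) : ℝ) : ℂ)) * A * Matrix.diagonal (fun k => (((Real.sqrt (W k))⁻¹ : ℝ) : ℂ))).det) :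
    IsUnit A.det ∧
      A⁻¹ = Matrix.diagonal (fun k => (((Real.sqrt (W k))⁻¹ : ℝ) : ℂ)) *
        (Matrix.diagonal (fun k => ((Real.sqrt (W k) : ℝ) : ℂ)) * A * Matrix.diagonal (fun k => (((Real.sqrt (W k))⁻¹ : ℝ) : ℂ)))⁻¹ *
          Matrix.diagonal (fun k => ((Real.sqrt (W k) : ℝ) : ℂ)) := by
  set D : Matrix n n ℂ := Matrix.diagonal (fun k => ((Real.sqrt (W k) : ℝ) : ℂ)) with hD
  set D' : Matrix n n ℂ := Matrix.diagonal (fun k => (((Real.sqrt (W k))⁻¹ : ℝ) : ℂ)) with hD'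
  have hs0 : ∀ i, Real.sqrt (W i) ≠ 0 := fun i => (Real.sqrt_pos.2 (hW i)).ne'
  have hDD' : D * D' = 1 := by
    rw [hD, hD', Matrix.diagonal_mul_diagonal, ← Matrix.diagonal_one]
    congr 1; funext k
    rw [← Complex.ofReal_mul, mul_inv_cancel₀ (hs0 k), Complex.ofReal_one]
  have hD'D : D' * D = 1 := by
    rw [hD, hD', Matrix.diagonal_mul_diagonal, ← Matrix.diagonal_one]
    congr 1; funext k
    rw [← Complex.ofReal_mul, inv_mul_cancel₀ (hs0 k), Complex.ofReal_one]
  -- `A = D′ (D A D′) D`, hence `A · (D′ B⁻¹ D) = D′ B (D D′) B⁻¹ D = D′ D = 1`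
  have hA' : D' * (D * A * D') * D = A := by
    calc D' * (D * A * D') * D = (D' * D) * A * (D' * D) := by simp only [Matrix.mul_assoc]
      _ = A := by rw [hD'D, Matrix.one_mul, Matrix.mul_one]
  have hright : A * (D' * (D * A * D')⁻¹ * D) = 1 := by
    calc A * (D' * (D * A * D')⁻¹ * D) = (D' * (D * A * D') * D) * (D' * (D * A * D')⁻¹ * D) := by rw [hA']
      _ = D' * ((D * A * D') * ((D * D') * (D * A * D')⁻¹)) * D := by simp only [Matrix.mul_assoc]
      _ = 1 := by rw [hDD', Matrix.one_mul, Matrix.mul_nonsing_inv _ hB, Matrix.mul_one, hD'D]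
  exact ⟨Matrix.isUnit_det_of_right_inverse hright, Matrix.inv_eq_right_inv hright⟩

end Conjugation

/-! ## §3. ★★★ The weighted statement -/

section Weighted

/-- ★★★ **COMBES–THOMAS FOR AN EXPONENTIALLY LOCALISED OPERATOR COERCIVE IN A WEIGHTED PAIRING** (the shape of [B9] Thm 3.2 (3.48) for `(Q′G′²Q′*)⁻¹`,
positive in the block-volume pairing): `A : Matrix n n ℂ` `m`-accretive in the `W`-weighted pairing (`W_i > 0`), `‖A i l‖ ≤ a·e^{−κ₀ d(i,l)}`, weight-ratio numeral
`√W_i ≤ Θ·√W_j`, half-rate volume sums `≤ c_V` (rows and columns) ⟹ for every `0 ≤ κ ≤ κ₀∕4` with `8(Θa)κc_V ≤ mκ₀`: `A` is invertible and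
`‖A⁻¹ i j‖ ≤ Θ·(4∕m)·e^{−κ d(i,j)}` (§2 conjugation + §1 + un-conjugation).
[cite: Balaban1985BackgroundPropagators, (3.25) p.394, Thm 3.2 (3.48) p.398, Thm 3.11 p.416; Balaban1984PropagatorsII, Lemma 2.1 (2.61) p.234, Prop 2.3 p.238;
Balaban1988RG2Cluster, (2.7) p.13; AizenmanWarzel2015, §10.3] -/
theorem inverse_decay_of_expDecay_weighted (d : n → n → ℝ) (hd0 : ∀ i, d i i = 0) (hds : ∀ i j, d i j = d j i)
    (hdt : ∀ i j k, d i k ≤ d i j + d j k) (hdnn : ∀ i j, 0 ≤ d i j) (W : n → ℝ) (hW : ∀ i, 0 < W i)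
    {Θ : ℝ} (hΘ : ∀ i j, Real.sqrt (W i) ≤ Θ * Real.sqrt (W j)) (A : Matrix n n ℂ)
    {m a κ₀ κ cV : ℝ} (hm : 0 < m) (ha : 0 ≤ a) (hκ₀ : 0 < κ₀) (hκ : 0 ≤ κ) (hκ4 : κ ≤ κ₀ / 4)
    (hκm : 8 * (Θ * a) * κ * cV ≤ m * κ₀)
    (hacc : ∀ v : n → ℂ, m * ∑ i, W i * ‖v i‖ ^ 2 ≤ (∑ i, (W i : ℂ) * (star (v i) * (A *ᵥ v) i)).re)
    (hA : ∀ i l, ‖A i l‖ ≤ a * Real.exp (-(κ₀ * d i l)))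
    (hvol : ∀ i, ∑ l, Real.exp (-(κ₀ / 2 * d i l)) ≤ cV) (hvol' : ∀ l, ∑ i, Real.exp (-(κ₀ / 2 * d i l)) ≤ cV) :
    IsUnit A.det ∧ ∀ i j, ‖A⁻¹ i j‖ ≤ Θ * (4 / m) * Real.exp (-(κ * d i j)) := by
  classical
  rcases isEmpty_or_nonempty n with hn | hne
  · -- the empty index type: `A = 1`, everything trivial
    refine ⟨?_, fun i _ => (IsEmpty.false i).elim⟩
    have hA1 : A = 1 := Subsingleton.elim _ _
    rw [hA1, Matrix.det_one]; exact isUnit_one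
  · obtain ⟨i₀⟩ := hne
    have hΘ0 : 0 ≤ Θ := by
      have h := hΘ i₀ i₀
      have hp := Real.sqrt_pos.2 (hW i₀)
      nlinarith
    set B : Matrix n n ℂ := Matrix.diagonal (fun k => ((Real.sqrt (W k) : ℝ) : ℂ)) * A *
      Matrix.diagonal (fun k => (((Real.sqrt (W k))⁻¹ : ℝ) : ℂ)) with hB
    have hBacc : ∀ v : n → ℂ, m * ∑ i, ‖v i‖ ^ 2 ≤ (∑ i, star (v i) * (B *ᵥ v) i).re :=
      accretive_conjDiag_of_weighted W A hW hacc
    have hBdec : ∀ i l, ‖B i l‖ ≤ Θ * a * Real.exp (-(κ₀ * d i l)) := norm_conjDiag_le W A hW hΘ d hA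
    obtain ⟨hBunit, hBinv⟩ := inverse_decay_of_expDecay d hd0 hds hdt hdnn B hm (mul_nonneg hΘ0 ha) hκ₀ hκ hκ4 hκm hBacc hBdec hvol hvol'
    obtain ⟨hAunit, hAinv⟩ := inv_eq_conjDiag_inv W A hW hBunit
    refine ⟨hAunit, fun i j => ?_⟩
    rw [hAinv, Matrix.mul_diagonal, Matrix.diagonal_mul, norm_mul, norm_mul, Complex.norm_real, Complex.norm_real, Real.norm_eq_abs,
      Real.norm_eq_abs, abs_of_pos (inv_pos.2 (Real.sqrt_pos.2 (hW i))), abs_of_pos (Real.sqrt_pos.2 (hW j))]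
    have hr : (Real.sqrt (W i))⁻¹ * Real.sqrt (W j) ≤ Θ := by
      rw [← div_eq_inv_mul, div_le_iff₀ (Real.sqrt_pos.2 (hW i))]; exact hΘ j i
    have h4 : 0 ≤ 4 / m * Real.exp (-(κ * d i j)) := mul_nonneg (div_nonneg (by norm_num) hm.le) (Real.exp_nonneg _)
    calc (Real.sqrt (W i))⁻¹ * ‖B⁻¹ i j‖ * Real.sqrt (W j) = ((Real.sqrt (W i))⁻¹ * Real.sqrt (W j)) * ‖B⁻¹ i j‖ := by ring
      _ ≤ Θ * (4 / m * Real.exp (-(κ * d i j))) := mul_le_mul hr (hBinv i j) (norm_nonneg _) hΘ0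
      _ = Θ * (4 / m) * Real.exp (-(κ * d i j)) := by ring

/-- **… at SOME strictly positive rate** depending on `(m; Θa, κ₀, c_V)` only.
[cite: Balaban1985BackgroundPropagators, Thm 3.2 (3.48) p.398; Balaban1988RG2Cluster, (2.7) p.13; AizenmanWarzel2015, §10.3] -/
theorem inverse_decay_of_expDecay_weighted_exists (d : n → n → ℝ) (hd0 : ∀ i, d i i = 0) (hds : ∀ i j, d i j = d j i)
    (hdt : ∀ i j k, d i k ≤ d i j + d j k) (hdnn : ∀ i j, 0 ≤ d i j) (W : n → ℝ) (hW : ∀ i, 0 < W i)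
    {Θ : ℝ} (hΘ0 : 0 ≤ Θ) (hΘ : ∀ i j, Real.sqrt (W i) ≤ Θ * Real.sqrt (W j)) (A : Matrix n n ℂ)
    {m a κ₀ cV : ℝ} (hm : 0 < m) (ha : 0 ≤ a) (hκ₀ : 0 < κ₀) (hcV : 0 ≤ cV)
    (hacc : ∀ v : n → ℂ, m * ∑ i, W i * ‖v i‖ ^ 2 ≤ (∑ i, (W i : ℂ) * (star (v i) * (A *ᵥ v) i)).re)
    (hA : ∀ i l, ‖A i l‖ ≤ a * Real.exp (-(κ₀ * d i l)))
    (hvol : ∀ i, ∑ l, Real.exp (-(κ₀ / 2 * d i l)) ≤ cV) (hvol' : ∀ l, ∑ i, Real.exp (-(κ₀ / 2 * d i l)) ≤ cV) :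
    ∃ κ : ℝ, 0 < κ ∧ IsUnit A.det ∧ ∀ i j, ‖A⁻¹ i j‖ ≤ Θ * (4 / m) * Real.exp (-(κ * d i j)) := by
  obtain ⟨κ, hκ0, hκ4, hκm⟩ := exists_uniform_rate (m := m) (a := Θ * a) (κ₀ := κ₀) (cV := cV) hm hκ₀ (mul_nonneg hΘ0 ha) hcV
  exact ⟨κ, hκ0, inverse_decay_of_expDecay_weighted d hd0 hds hdt hdnn W hW hΘ A hm ha hκ₀ hκ0.le hκ4 hκm hacc hA hvol hvol'⟩

end Weighted

end Literature.MathematicalPhysics.QuantumFieldTheory.Balaban1983to89.B13InverseDecayWeightedPairing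

end
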